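import Literature.NumberTheory.CubicFields.DeloneFaddeevRing
import Mathlib.LinearAlgebra.FreeModule.PID
import Mathlib.RingTheory.Polynomial.ScaleRoots
import Mathlib.RingTheory.IntegralClosure.Algebra.Basic
import HarnessLib

/-!
# Every cubic ring with a basis `1, ω, θ` is the ring of a binary cubic form (Levi–Delone–Faddeev, surjectivity)

Topic `Literature/NumberTheory/CubicFields`, continuing `DeloneFaddeevRing.lean` (the cubic ring
`R(f)` of a form, `RingOfForm f`, with basis `1, ω, θ` and table `ωθ = −ad`, `ω² = −ac + bω − aθ`,
`θ² = −bd + dω − cθ`).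

Bhargava–Taniguchi–Thorne 2023, Thm 2.1 (Levi, Delone–Faddeev, Gan–Gross–Savin; proof as in
Bhargava–Shankar–Tsimerman §2 / Gan–Gross–Savin Prop. 4.2): every cubic ring arises as some
`R(f)`. The printed argument: given a `ℤ`-basis `1, ω, θ` of a cubic ring `R`, translating `ω`
and `θ` by integers one may assume `ωθ ∈ ℤ` (a "normal basis"); writing then
`ω² = M + bω − aθ`, `θ² = L + dω − cθ`, `ωθ = k` with integers `a, b, c, d, M, L, k`, the
associative law (`(ω²)θ = ω(ωθ)` and `(θ²)ω = θ(θω)`, compared coefficientwise) forces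
`M = −ac`, `L = −bd`, `k = −ad`, i.e. the multiplication table of `R(f)` for `f = (a, b, c, d)`.
This file PROVES exactly that:

* `RingOfForm.exists_ringEquiv_of_basis` — **for a commutative ring `R` with a `ℤ`-basis
  `b : Fin 3 → R` with `b 0 = 1`, there is a binary cubic form `f` with `R(f) ≅ R`.**

* `RingOfForm.isUnit_of_one_eq_zsmul`, `RingOfForm.exists_basis_apply_zero_eq_one` — in a
  commutative ring free of rank `3` over `ℤ`, `1` is primitive (integrality + `scaleRoots`), hence
  (Smith normal form for `ℤ·1`) part of a basis `(1, ω, θ)`;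
* `RingOfForm.exists_ringEquiv_of_finrank_eq_three` — **every cubic ring in the sense of BTT §2.1
  (commutative, free of rank `3` over `ℤ`) is `≅ R(f)` for some integral binary cubic form `f`.**

Together with `DeloneFaddeevEquivariance.lean` (`GL₂(ℤ)`-equivalent forms give isomorphic
rings) this is the existence-and-well-definedness skeleton of Thm 2.1; NOT here: injectivity on
orbits (isomorphic rings come from equivalent forms) and `Aut(R(f)) ≅ Stab(f)`.

## References

* M. Bhargava, T. Taniguchi, F. Thorne, *Improved error estimates for the Davenport–Heilbronn
  theorems*, Math. Ann. 389 (2024) = arXiv:2107.12819, Thm 2.1 [BhargavaTaniguchiThorne2023].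
* M. Bhargava, A. Shankar, J. Tsimerman, *On the Davenport–Heilbronn theorems and second order
  terms*, Invent. Math. 193 (2013), §2 [BhargavaShankarTsimerman2012].
* W. T. Gan, B. Gross, G. Savin, *Fourier coefficients of modular forms on `G₂`*, Duke Math. J.
  115 (2002), Prop. 4.2 [GanGrossSavin2002].
-/

namespace Literature.NumberTheory.CubicFields

namespace RingOfForm

open Module

variable {R : Type*} [CommRing R]

/-- **Levi–Delone–Faddeev, surjectivity for rings with a basis through `1`.** Let `R` be a
commutative ring which is free of rank `3` over `ℤ` with a basis `b = (1, ω, θ)`. Then `R ≅ R(f)`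
for some integral binary cubic form `f`: after the normalization `ω ↦ ω − n₂`, `θ ↦ θ − n₁`
(`ωθ = n₀ + n₁ω + n₂θ`) one has `ωθ ∈ ℤ`, and associativity forces the table
`ωθ = −ad`, `ω² = −ac + bω − aθ`, `θ² = −bd + dω − cθ` (BST §2; GGS Prop. 4.2; BTT Thm 2.1).
Explicit version: writing `cᵢⱼₖ` for the `b`-coordinates of `bᵢ bⱼ`, the form is
`f = (−c₁₁₂, c₁₁₁ − 2c₁₂₂, 2c₁₂₁ − c₂₂₂, c₂₂₁)` (the index form of `b`) and the isomorphism is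
`x + yω + zθ ↦ x + y (b₁ − c₁₂₂) + z (b₂ − c₁₂₁)`.
[cite: BhargavaTaniguchiThorne2023, Theorem 2.1 (every cubic ring is some R(f))] -/
theorem exists_ringEquiv_of_basis_explicit (b : Basis (Fin 3) ℤ R) (hb : b 0 = 1) :
    ∃ e : RingOfForm (⟨-(b.repr (b 1 * b 1) 2), b.repr (b 1 * b 1) 1 - 2 * b.repr (b 1 * b 2) 2,
        2 * b.repr (b 1 * b 2) 1 - b.repr (b 2 * b 2) 2, b.repr (b 2 * b 2) 1⟩ : BinaryCubic ℤ) ≃+* R,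
      ∀ P, e P = (P.x : R) + (P.y : R) * (b 1 - (b.repr (b 1 * b 2) 2 : R))
        + (P.z : R) * (b 2 - (b.repr (b 1 * b 2) 1 : R)) := by
  classical
  -- coordinates with respect to `b = (1, ω, θ)`
  have hrepr : ∀ r : R,
      r = (b.repr r 0 : R) + (b.repr r 1 : R) * b 1 + (b.repr r 2 : R) * b 2 := by
    intro r
    conv_lhs => rw [← b.sum_repr r]
    simp only [Fin.sum_univ_three, zsmul_eq_mul, hb, mul_one]
  have hindep : ∀ x y z : ℤ, (x : R) + (y : R) * b 1 + (z : R) * b 2 = 0 → x = 0 ∧ y = 0 ∧ z = 0 := by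
    intro x y z h
    have e : b.repr ((x : R) + (y : R) * b 1 + (z : R) * b 2) =
        Finsupp.single 0 x + Finsupp.single 1 y + Finsupp.single 2 z := by
      have h1 : (x : R) = x • b 0 := by rw [hb, zsmul_eq_mul, mul_one]
      have h2 : (y : R) * b 1 = y • b 1 := by rw [zsmul_eq_mul]
      have h3 : (z : R) * b 2 = z • b 2 := by rw [zsmul_eq_mul]
      rw [h1, h2, h3]
      simp only [map_add, map_zsmul, Basis.repr_self, Finsupp.smul_single, smul_eq_mul, mul_one]
    have h' := congrArg b.repr h
    rw [map_zero, e] at h'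
    have h0 := DFunLike.congr_fun h' 0
    have h1 := DFunLike.congr_fun h' 1
    have h2 := DFunLike.congr_fun h' 2
    simp at h0 h1 h2
    exact ⟨h0, h1, h2⟩
  -- normalization: `ω' = ω − n₂`, `θ' = θ − n₁`, so that `ω'θ' ∈ ℤ`
  set n := b.repr (b 1 * b 2) with hn
  set ω' : R := b 1 - (n 2 : ℤ) with hω'
  set θ' : R := b 2 - (n 1 : ℤ) with hθ'
  have hindep' : ∀ x y z : ℤ, (x : R) + (y : R) * ω' + (z : R) * θ' = 0 → x = 0 ∧ y = 0 ∧ z = 0 := by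
    intro x y z h
    have h2 : ((x - y * n 2 - z * n 1 : ℤ) : R) + (y : R) * b 1 + (z : R) * b 2 = 0 := by
      rw [← h, hω', hθ']
      push_cast
      ring
    obtain ⟨h0, h1, h2'⟩ := hindep _ _ _ h2
    refine ⟨?_, h1, h2'⟩
    rw [h1, h2'] at h0
    simpa using h0
  -- structure constants in the basis `(1, ω', θ')` versus `(1, b₁, b₂)`
  set m := b.repr (ω' * ω') with hm
  set l := b.repr (θ' * θ') with hl
  have hsqω : ω' * ω' = (n 2 * n 2) • b 0 + (-(2 * n 2)) • b 1 + (b 1 * b 1) := by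
    rw [hω', hb]
    simp only [zsmul_eq_mul]
    push_cast
    ring
  have hsqθ : θ' * θ' = (n 1 * n 1) • b 0 + (-(2 * n 1)) • b 2 + (b 2 * b 2) := by
    rw [hθ', hb]
    simp only [zsmul_eq_mul]
    push_cast
    ring
  have hm1 : m 1 = b.repr (b 1 * b 1) 1 - 2 * n 2 := by
    rw [hm, hsqω]
    simp only [map_add, map_zsmul, Basis.repr_self, Finsupp.add_apply, Finsupp.smul_apply, smul_eq_mul]
    simp
    ring
  have hm2 : m 2 = b.repr (b 1 * b 1) 2 := by
    rw [hm, hsqω]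
    simp only [map_add, map_zsmul, Basis.repr_self, Finsupp.add_apply, Finsupp.smul_apply, smul_eq_mul]
    simp
  have hl1 : l 1 = b.repr (b 2 * b 2) 1 := by
    rw [hl, hsqθ]
    simp only [map_add, map_zsmul, Basis.repr_self, Finsupp.add_apply, Finsupp.smul_apply, smul_eq_mul]
    simp
  have hl2 : l 2 = b.repr (b 2 * b 2) 2 - 2 * n 1 := by
    rw [hl, hsqθ]
    simp only [map_add, map_zsmul, Basis.repr_self, Finsupp.add_apply, Finsupp.smul_apply, smul_eq_mul]
    simp
    ring
  set a : ℤ := -(b.repr (b 1 * b 1) 2) with ha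
  set bb : ℤ := b.repr (b 1 * b 1) 1 - 2 * n 2 with hbb
  set c : ℤ := 2 * n 1 - b.repr (b 2 * b 2) 2 with hc
  set d : ℤ := b.repr (b 2 * b 2) 1 with hd
  set M : ℤ := m 0 + bb * n 2 - a * n 1 with hM
  set L : ℤ := l 0 + d * n 2 - c * n 1 with hL
  set k : ℤ := n 0 + n 1 * n 2 with hk
  have hω2 : ω' * ω' = (M : R) + (bb : R) * ω' - (a : R) * θ' := by
    have h := hrepr (ω' * ω')
    rw [← hm] at h
    rw [h, hm1, hm2, hM, hbb, ha, hω', hθ']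
    push_cast
    ring
  have hθ2 : θ' * θ' = (L : R) + (d : R) * ω' - (c : R) * θ' := by
    have h := hrepr (θ' * θ')
    rw [← hl] at h
    rw [h, hl1, hl2, hL, hd, hc, hω', hθ']
    push_cast
    ring
  have hωθ : ω' * θ' = (k : R) := by
    have h := hrepr (b 1 * b 2)
    rw [hk, hω', hθ']
    push_cast
    linear_combination h
  -- associativity forces `k = −ad`, `M = −ac`, `L = −bd`
  have hX : ((bb * k - a * L : ℤ) : R) + ((-(a * d) - k : ℤ) : R) * ω' + ((M + a * c : ℤ) : R) * θ' = 0 := by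
    push_cast
    linear_combination (-θ') * hω2 + (a : R) * hθ2 + (ω' - (bb : R)) * hωθ
  have hY : ((d * M - c * k : ℤ) : R) + ((L + bb * d : ℤ) : R) * ω' + ((-(a * d) - k : ℤ) : R) * θ' = 0 := by
    push_cast
    linear_combination (-ω') * hθ2 + (-(d : R)) * hω2 + (θ' + (c : R)) * hωθ
  obtain ⟨-, hk1, hM1⟩ := hindep' _ _ _ hX
  obtain ⟨-, hL1, -⟩ := hindep' _ _ _ hY
  have rω2 : ω' * ω' = -((a : R) * c) + (bb : R) * ω' - (a : R) * θ' := by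
    rw [hω2]
    have : (M : R) = -((a : R) * c) := by
      have h : M = -(a * c) := by linarith
      rw [h]
      push_cast
      ring
    rw [this]
  have rθ2 : θ' * θ' = -((bb : R) * d) + (d : R) * ω' - (c : R) * θ' := by
    rw [hθ2]
    have : (L : R) = -((bb : R) * d) := by
      have h : L = -(bb * d) := by linarith
      rw [h]
      push_cast
      ring
    rw [this]
  have rωθ : ω' * θ' = -((a : R) * d) := by
    rw [hωθ]
    have h : k = -(a * d) := by linarith
    rw [h]
    push_cast
    ring
  -- the form and the isomorphism `(x, y, z) ↦ x + y ω' + z θ'`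
  let f : BinaryCubic ℤ := ⟨a, bb, c, d⟩
  let φ : RingOfForm f →+* R :=
    { toFun := fun P => (P.x : R) + (P.y : R) * ω' + (P.z : R) * θ'
      map_one' := by simp
      map_mul' := by
        intro P Q
        simp only [mul_x, mul_y, mul_z, f]
        push_cast
        linear_combination (-((P.y : R) * Q.y)) * rω2 + (-((P.z : R) * Q.z)) * rθ2
          + (-((P.y : R) * Q.z + (P.z : R) * Q.y)) * rωθ
      map_zero' := by simp
      map_add' := by
        intro P Q
        simp only [add_x, add_y, add_z]
        push_cast
        ring }
  have hφ : ∀ P : RingOfForm f, φ P = (P.x : R) + (P.y : R) * ω' + (P.z : R) * θ' := fun P => rfl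
  refine ⟨RingEquiv.ofBijective φ ⟨?_, ?_⟩, fun P => rfl⟩
  · -- injective
    intro P Q hPQ
    rw [hφ, hφ] at hPQ
    have h0 : ((P.x - Q.x : ℤ) : R) + ((P.y - Q.y : ℤ) : R) * ω' + ((P.z - Q.z : ℤ) : R) * θ' = 0 := by
      push_cast
      linear_combination hPQ
    obtain ⟨hx, hy, hz⟩ := hindep' _ _ _ h0
    ext <;> omega
  · -- surjective
    intro r
    refine ⟨⟨b.repr r 0 + b.repr r 1 * n 2 + b.repr r 2 * n 1, b.repr r 1, b.repr r 2⟩, ?_⟩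
    rw [hφ]
    conv_rhs => rw [hrepr r]
    simp only [hω', hθ']
    push_cast
    ring

/-- **Levi–Delone–Faddeev, surjectivity for rings with a basis through `1`** (BTT 2023, Thm 2.1;
GGS Prop. 4.2): a commutative ring with a `ℤ`-basis `(1, ω, θ)` is `≅ R(f)` for some integral
binary cubic form `f`. [cite: BhargavaTaniguchiThorne2023, Theorem 2.1 (every cubic ring is some R(f))] -/
theorem exists_ringEquiv_of_basis (b : Basis (Fin 3) ℤ R) (hb : b 0 = 1) :
    ∃ f : BinaryCubic ℤ, Nonempty (RingOfForm f ≃+* R) := by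
  obtain ⟨e, -⟩ := exists_ringEquiv_of_basis_explicit b hb
  exact ⟨_, ⟨e⟩⟩

/-- The same, stated for a basis indexed by any three-element type through an equivalence with
`Fin 3`: a commutative ring with a `ℤ`-basis one of whose vectors is `1` is some `R(f)`. [folklore] -/
theorem exists_ringEquiv_of_basis' {ι : Type*} (b : Basis ι ℤ R) (i : ι) (hi : b i = 1)
    (e : ι ≃ Fin 3) (he : e i = 0) : ∃ f : BinaryCubic ℤ, Nonempty (RingOfForm f ≃+* R) := by
  refine exists_ringEquiv_of_basis (b.reindex e) ?_
  rw [Basis.reindex_apply, ← he, Equiv.symm_apply_apply, hi]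

/-! ### Every cubic ring has a basis through `1` -/

/-- **`1` is primitive in a cubic ring** (indeed in any commutative ring which is a finite
torsion-free `ℤ`-module): if `1 = t • y` then `t = ±1`. Proof: `y` is integral over `ℤ`; scaling a
monic relation `p(y) = 0` of degree `n` by `t` gives `(p.scaleRoots t)(t y) = (p.scaleRoots t)(1) = 0`,
i.e. `1 + Σ_{i<n} p_i t^{n-i} = 0` in `ℤ`, so `t ∣ 1`. [folklore] -/
theorem isUnit_of_one_eq_zsmul {S : Type*} [CommRing S] [Module.Finite ℤ S]
    [Module.IsTorsionFree ℤ S] [Nontrivial S] {t : ℤ} {y : S} (h : (1 : S) = t • y) : IsUnit t := by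
  obtain ⟨p, hmonic, hp⟩ : IsIntegral ℤ y := Algebra.IsIntegral.isIntegral y
  have hq : Polynomial.eval₂ (algebraMap ℤ S) 1 (p.scaleRoots t) = 0 := by
    have h1 := Polynomial.scaleRoots_eval₂_eq_zero (algebraMap ℤ S) (s := t) hp
    rwa [Algebra.algebraMap_eq_smul_one, smul_mul_assoc, one_mul, ← h] at h1
  have hz : (p.scaleRoots t).eval 1 = 0 := by
    rw [Polynomial.eval₂_at_one, Algebra.algebraMap_eq_smul_one, smul_eq_zero] at hq
    exact hq.resolve_right one_ne_zero
  rw [Polynomial.eval_eq_sum_range, Polynomial.natDegree_scaleRoots, Finset.sum_range_succ] at hz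
  simp only [one_pow, mul_one, Polynomial.coeff_scaleRoots, Nat.sub_self, pow_zero,
    hmonic.coeff_natDegree] at hz
  -- `hz : Σ_{i<n} p_i t^{n-i} + 1 = 0`, and `t` divides the sum
  have hdvd : t ∣ ∑ i ∈ Finset.range p.natDegree, p.coeff i * t ^ (p.natDegree - i) :=
    Finset.dvd_sum fun i hi =>
      Dvd.dvd.mul_left (dvd_pow_self t (Nat.sub_ne_zero_of_lt (Finset.mem_range.mp hi))) _
  rw [isUnit_iff_dvd_one]
  have h1 : (1 : ℤ) = -∑ i ∈ Finset.range p.natDegree, p.coeff i * t ^ (p.natDegree - i) := by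
    linarith
  rw [h1]
  exact hdvd.neg_right

/-- **A cubic ring has a `ℤ`-basis `(1, ω, θ)`**: a commutative ring which is free of rank `3`
over `ℤ` (BTT 2023, §2.1) admits a basis whose first vector is `1` (Smith normal form for the
submodule `ℤ·1`, which is saturated by `isUnit_of_one_eq_zsmul`). [folklore] -/
theorem exists_basis_apply_zero_eq_one {S : Type*} [CommRing S] [Module.Free ℤ S]
    [Module.Finite ℤ S] (h3 : Module.finrank ℤ S = 3) :
    ∃ b : Basis (Fin 3) ℤ S, b 0 = 1 := by
  classical
  haveI : Nontrivial S := Module.nontrivial_of_finrank_pos (R := ℤ) (by omega)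
  let b₀ : Basis (Fin 3) ℤ S := Module.finBasisOfFinrankEq ℤ S h3
  let N : Submodule ℤ S := Submodule.span ℤ {(1 : S)}
  obtain ⟨n, snf⟩ := Submodule.smithNormalForm b₀ N
  -- `N = ℤ·1` has rank `1`, so `n = 1`
  have hli : LinearIndependent ℤ (fun _ : Fin 1 => (1 : S)) :=
    linearIndependent_unique_iff.mpr one_ne_zero
  have hN1 : Module.finrank ℤ N = 1 := by
    have hrange : Set.range (fun _ : Fin 1 => (1 : S)) = {1} := by
      ext x; simp
    have bN1 : Basis (Fin 1) ℤ N := (Basis.span hli).map (LinearEquiv.ofEq _ _ (by rw [hrange]))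
    rw [Module.finrank_eq_card_basis bN1, Fintype.card_fin]
  have hn : n = 1 := by
    have := Module.finrank_eq_card_basis snf.bN
    rw [hN1, Fintype.card_fin] at this
    exact this.symm
  subst hn
  -- `1 = c • bN 0 = (c * a 0) • bM (f 0)`, so `c * a 0 = ±1`
  have h1N : (1 : S) ∈ N := Submodule.mem_span_singleton_self (1 : S)
  set c : ℤ := snf.bN.repr ⟨1, h1N⟩ 0 with hc
  have h1 : (1 : S) = (c * snf.a 0) • snf.bM (snf.f 0) := by
    have hsum := snf.bN.sum_repr ⟨1, h1N⟩
    rw [Fin.sum_univ_one] at hsum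
    have hval := congrArg Subtype.val hsum
    simp only [Submodule.coe_smul_of_tower] at hval
    rw [snf.snf 0, ← mul_smul] at hval
    exact hval.symm
  obtain ⟨u, hu⟩ := isUnit_of_one_eq_zsmul h1
  -- rescale the basis vector `bM (f 0)` by the unit `u` and move it to index `0`
  let w : Fin 3 → ℤˣ := fun j => if j = snf.f 0 then u else 1
  refine ⟨(snf.bM.unitsSMul w).reindex (Equiv.swap (snf.f 0) 0), ?_⟩
  rw [Basis.reindex_apply, Equiv.symm_swap, Equiv.swap_apply_right, Basis.unitsSMul_apply]
  simp only [w, if_pos rfl]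
  rw [Units.smul_def, hu, ← h1]

/-- **Every cubic ring is the ring of a binary cubic form** (Levi–Delone–Faddeev; BTT 2023,
Thm 2.1, surjectivity, with BTT's definition §2.1 "a commutative ring that is free of rank 3 as a
`ℤ`-module"): for such `R` there is an integral binary cubic form `f` with `R(f) ≅ R`.
[cite: BhargavaTaniguchiThorne2023, Theorem 2.1 (every cubic ring is some R(f))] -/
theorem exists_ringEquiv_of_finrank_eq_three [Module.Free ℤ R] [Module.Finite ℤ R]
    (h3 : Module.finrank ℤ R = 3) : ∃ f : BinaryCubic ℤ, Nonempty (RingOfForm f ≃+* R) := by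
  obtain ⟨b, hb⟩ := exists_basis_apply_zero_eq_one h3
  exact exists_ringEquiv_of_basis b hb

end RingOfForm

end Literature.NumberTheory.CubicFields
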